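import Summits.MatrixMultiplication.MatrixMultiplication.Theorems.LevelGradedCohnUmansLevelOneGL2DesignsMultiquadraticSqrtIndep
import Summits.MatrixMultiplication.MatrixMultiplication.Theorems.LevelGradedCohnUmansLevelOneGL2DesignsMultiquadraticOrder

/-!
# No wrap-around for the multiquadratic order (wall-breaker axis `parabola lifts over finite fields`, stub
`stub_tangencySets` of the crux `LevelOneGL2Designs`, stmt-MatrixMultiplication-14080 — all-primes trace-zero lift,
file 3)

Let `ℓ : ι → ℕ` be an injective family of primes, `𝒮` a set of index sets containing `∅` and closed under `∆` (so
`R_𝒮 = ⊕_{S∈𝒮} ℤ√ℓ_S` is a sub-order of `ℤ[√ℓ_i : i]` of rank `d = |𝒮|`), and `z : Finset ι → ℤ` supported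
on `𝒮`.  Multiplication by `z` on `R_𝒮` is the `d × d` integer matrix `M_z(U,T) = z_{U∆T} · ℓ_{T∖U}`
(`mulVec_eq_star`).  If `t_i² = ℓ_i` in a commutative ring then the vector `(∏_{i∈U} t_i)_{U∈𝒮}` is a LEFT
eigenvector of `M_z` with eigenvalue `E_t(z) = Σ_S z_S ∏_{i∈S} t_i` (`root_vecMul`).  Hence, over a field `F`
of characteristic `q` in which the reduction `E_t(z)` vanishes, `det M_z ≡ 0 (mod q)`; as
`|det M_z| ≤ d!·(‖z‖_∞ · ∏ℓ_i)^d` (`abs_det_le`), a small `z` has `det M_z = 0`, so `z ⋆ u = 0` for a non-zero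
integer vector `u`, and evaluating in `ℝ` at `t_i = √ℓ_i` (where the evaluation is injective, `sqrt_prod_indep_int`,
and `ℝ` has no zero-divisors) gives `z = 0`:

* `eq_zero_of_eval_eq_zero` — **no wrap-around**: `E_t(z) = 0` in `F`, `|z_S| ≤ B`, `d!(B∏ℓ_i)^d < q` ⇒ `z = 0`.

This is the explicit-coordinate form, for the orders `R_𝒮`, of the norm argument of Pohoata 2026, Prop. 5.1
(`q ∣ N_{K/ℚ}(D)`, `|N(D)| < q` ⇒ `D = 0`), with `det M_z = N_{K_𝒮/ℚ}(z)` never named.  No definitions.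
-/

-- the summit/problem path `MatrixMultiplication.MatrixMultiplication` is fixed by the tree layout (D-0017)
set_option linter.dupNamespace false

noncomputable section

open Finset Matrix

namespace Summit.MatrixMultiplication.MatrixMultiplication.Theorems.LevelOneGL2Designs.Multiquadratic

variable {ι : Type*} [Fintype ι] [DecidableEq ι] (ℓ : ι → ℕ)

/-- **The multiplication matrix acts as the order product**: for `u : 𝒮 → ℤ` extended by zero to `ū`,
`(M_z u)_U = (z ⋆ ū)_U` for `U ∈ 𝒮` (reindex `T = S ∆ U`). [elementary] -/
theorem mulVec_eq_star {𝒮 : Finset (Finset ι)} (z : Finset ι → ℤ) (u : ↥𝒮 → ℤ) (U : ↥𝒮) :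
    ((Matrix.of fun U T : ↥𝒮 => z (symmDiff (U : Finset ι) T) * ∏ i ∈ (T : Finset ι) \ U, (ℓ i : ℤ)) *ᵥ u) U
      = ∑ S : Finset ι, z S * (fun S => if h : S ∈ 𝒮 then u ⟨S, h⟩ else 0) (symmDiff S U) *
          ∏ i ∈ S \ (U : Finset ι), (ℓ i : ℤ) := by
  classical
  simp only [Matrix.mulVec, dotProduct, Matrix.of_apply]
  -- right-hand side: reindex `S ↦ T = S ∆ U`
  let e : Finset ι ≃ Finset ι :=
    { toFun := fun T => symmDiff (U : Finset ι) T
      invFun := fun S => symmDiff (U : Finset ι) S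
      left_inv := fun T => symmDiff_symmDiff_cancel_left _ T
      right_inv := fun S => symmDiff_symmDiff_cancel_left _ S }
  have hR : (∑ S : Finset ι, z S * (fun S => if h : S ∈ 𝒮 then u ⟨S, h⟩ else 0) (symmDiff S U) *
      ∏ i ∈ S \ (U : Finset ι), (ℓ i : ℤ)) =
      ∑ T : Finset ι, z (symmDiff (U : Finset ι) T) * (fun S => if h : S ∈ 𝒮 then u ⟨S, h⟩ else 0) T *
        ∏ i ∈ T \ (U : Finset ι), (ℓ i : ℤ) := by
    rw [← e.sum_comp]
    refine Finset.sum_congr rfl fun T _ => ?_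
    have h1 : symmDiff (symmDiff (U : Finset ι) T) (U : Finset ι) = T := by
      rw [symmDiff_comm, symmDiff_symmDiff_cancel_left]
    have h2 : symmDiff (U : Finset ι) T \ (U : Finset ι) = T \ U := by
      ext p; simp only [Finset.mem_sdiff, Finset.mem_symmDiff]; tauto
    simp only [e, Equiv.coe_fn_mk, h1, h2]
  rw [hR]
  -- restrict the sum to `𝒮`
  have step1 : (∑ x : ↥𝒮, (z (symmDiff (U : Finset ι) x) * ∏ i ∈ (x : Finset ι) \ U, (ℓ i : ℤ)) * u x) =
      ∑ T ∈ 𝒮, z (symmDiff (U : Finset ι) T) * (fun S => if h : S ∈ 𝒮 then u ⟨S, h⟩ else 0) T *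
        ∏ i ∈ T \ (U : Finset ι), (ℓ i : ℤ) := by
    rw [← Finset.sum_coe_sort 𝒮]
    refine Finset.sum_congr rfl fun x _ => ?_
    simp only [dif_pos x.2, Subtype.coe_eta]; ring
  rw [step1]
  exact Finset.sum_subset (Finset.subset_univ 𝒮) fun T _ hT => by simp only [dif_neg hT, mul_zero, zero_mul]

/-- **Left eigenvector**: if `t_i² = ℓ_i` in a commutative ring `R`, `𝒮` is closed under `∆` and `z` is supported
on `𝒮`, then `(∏_{U} t) M_z = E_t(z) · (∏_{T} t)` coordinatewise: the evaluation `E_t` is a ring homomorphism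
on `R_𝒮`, read on the basis. [elementary] -/
theorem root_vecMul {R : Type*} [CommRing R] (t : ι → R) (ht : ∀ i, t i ^ 2 = (ℓ i : R))
    {𝒮 : Finset (Finset ι)} (hΔ : ∀ S ∈ 𝒮, ∀ T ∈ 𝒮, symmDiff S T ∈ 𝒮)
    (z : Finset ι → ℤ) (hz : ∀ S, S ∉ 𝒮 → z S = 0) (T : ↥𝒮) :
    ((fun U : ↥𝒮 => ∏ i ∈ (U : Finset ι), t i) ᵥ*
      ((Matrix.of fun U T : ↥𝒮 => z (symmDiff (U : Finset ι) T) * ∏ i ∈ (T : Finset ι) \ U, (ℓ i : ℤ)).map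
        (Int.castRingHom R))) T
      = (∑ S : Finset ι, (z S : R) * ∏ i ∈ S, t i) * ∏ i ∈ (T : Finset ι), t i := by
  classical
  simp only [Matrix.vecMul, dotProduct, Matrix.map_apply, Matrix.of_apply, eq_intCast, Int.cast_mul,
    Int.cast_prod, Int.cast_natCast]
  -- right-hand side: expand and use the multiplication table, then reindex `S = U ∆ T`
  rw [Finset.sum_mul]
  have hrhs : ∀ S : Finset ι, (z S : R) * (∏ i ∈ S, t i) * ∏ i ∈ (T : Finset ι), t i =
      (z S : R) * (∏ i ∈ S ∩ T, (ℓ i : R)) * ∏ i ∈ symmDiff S T, t i := by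
    intro S; rw [mul_assoc, prod_root_mul ℓ t ht S T, mul_assoc]
  simp_rw [hrhs]
  let e : Finset ι ≃ Finset ι :=
    { toFun := fun U => symmDiff U (T : Finset ι)
      invFun := fun S => symmDiff S (T : Finset ι)
      left_inv := fun U => by simp
      right_inv := fun S => by simp }
  rw [← e.sum_comp]
  have he : ∀ U : Finset ι, (z (e U) : R) * (∏ i ∈ e U ∩ T, (ℓ i : R)) * ∏ i ∈ symmDiff (e U) T, t i =
      (∏ i ∈ U, t i) * ((z (symmDiff U T) : R) * ∏ i ∈ (T : Finset ι) \ U, (ℓ i : R)) := by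
    intro U
    have h1 : symmDiff (symmDiff U (T : Finset ι)) T = U := by simp
    have h2 : symmDiff U (T : Finset ι) ∩ T = (T : Finset ι) \ U := by
      ext p; simp only [Finset.mem_inter, Finset.mem_symmDiff, Finset.mem_sdiff]; tauto
    simp only [e, Equiv.coe_fn_mk, h1, h2]
    ring
  simp_rw [he]
  -- restrict to `U ∈ 𝒮`: off `𝒮` the coefficient `z_{U ∆ T}` vanishes
  symm
  rw [← Finset.sum_subset (Finset.subset_univ 𝒮)]
  · rw [← Finset.sum_coe_sort]
  · intro U _ hU
    have : symmDiff U (T : Finset ι) ∉ 𝒮 := by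
      intro h
      have := hΔ _ h _ T.2
      rw [symmDiff_assoc, symmDiff_self, symmDiff_bot] at this
      exact hU this
    rw [hz _ this]
    simp

/-- **Determinant bound**: if `|z_S| ≤ B` for all `S` then `|det M_z| ≤ d! · (B · ∏_i ℓ_i)^d`, `d = |𝒮|`.
[elementary, Hadamard-free] -/
theorem abs_det_le (hℓ : ∀ i, 1 ≤ ℓ i) {𝒮 : Finset (Finset ι)} (z : Finset ι → ℤ) {B : ℤ}
    (hB : ∀ S, |z S| ≤ B) :
    |(Matrix.of fun U T : ↥𝒮 => z (symmDiff (U : Finset ι) T) * ∏ i ∈ (T : Finset ι) \ U, (ℓ i : ℤ)).det|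
      ≤ (𝒮.card.factorial : ℤ) * (B * ∏ i, (ℓ i : ℤ)) ^ 𝒮.card := by
  classical
  have h := Matrix.det_le (abv := AbsoluteValue.abs) (x := B * ∏ i, (ℓ i : ℤ))
    (A := Matrix.of fun U T : ↥𝒮 => z (symmDiff (U : Finset ι) T) * ∏ i ∈ (T : Finset ι) \ U, (ℓ i : ℤ))
    (fun U T => by
      rw [Matrix.of_apply, AbsoluteValue.abs_apply, abs_mul]
      refine mul_le_mul (hB _) ?_ (abs_nonneg _) (le_trans (abs_nonneg _) (hB ∅))
      rw [abs_of_nonneg (Finset.prod_nonneg fun i _ => by positivity)]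
      exact_mod_cast prod_le_prod_univ ℓ hℓ _)
  rw [AbsoluteValue.abs_apply, Fintype.card_coe, nsmul_eq_mul] at h
  exact h

/-- **No wrap-around** (Pohoata 2026, Prop. 5.1, norm step, for the multiquadratic orders): let `ℓ` be an injective
family of primes, `𝒮 ∋ ∅` closed under `∆`, `z` supported on `𝒮` with `|z_S| ≤ B` and `d!(B∏ℓ_i)^d < q`
(`d = |𝒮|`).  If in some field `F` of characteristic `q` with square roots `t_i² = ℓ_i` the reduction
`E_t(z) = Σ_S z_S ∏_{i∈S} t_i` vanishes, then `z = 0`.  (Left eigenvector ⇒ `q ∣ det M_z`; the bound ⇒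
`det M_z = 0` ⇒ `M_z u = 0`, `u ≠ 0` ⇒ `E_√(z)·E_√(u) = E_√(z ⋆ u) = 0` in `ℝ` ⇒ `z = 0` by independence of
the `√ℓ_S`.) [Pohoata 2026 Prop. 5.1 (norm argument), explicit form] -/
theorem eq_zero_of_eval_eq_zero (hprime : ∀ i, (ℓ i).Prime) (hinj : Function.Injective ℓ)
    {𝒮 : Finset (Finset ι)} (h0 : ∅ ∈ 𝒮) (hΔ : ∀ S ∈ 𝒮, ∀ T ∈ 𝒮, symmDiff S T ∈ 𝒮)
    {z : Finset ι → ℤ} (hz : ∀ S, S ∉ 𝒮 → z S = 0) {B : ℤ} (hB : ∀ S, |z S| ≤ B)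
    {q : ℕ} (hq : (𝒮.card.factorial : ℤ) * (B * ∏ i, (ℓ i : ℤ)) ^ 𝒮.card < q)
    {F : Type*} [Field F] [CharP F q] (t : ι → F) (ht : ∀ i, t i ^ 2 = (ℓ i : F))
    (hE : (∑ S : Finset ι, (z S : F) * ∏ i ∈ S, t i) = 0) : z = 0 := by
  classical
  have hℓ : ∀ i, 1 ≤ ℓ i := fun i => (hprime i).one_lt.le
  set M : Matrix ↥𝒮 ↥𝒮 ℤ :=
    Matrix.of fun U T : ↥𝒮 => z (symmDiff (U : Finset ι) T) * ∏ i ∈ (T : Finset ι) \ U, (ℓ i : ℤ) with hM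
  -- (1) `det M ≡ 0 (mod q)`: the root vector is a non-zero left null vector of `M mod q`
  have hdetF : (M.map (Int.castRingHom F)).det = 0 := by
    refine Matrix.exists_vecMul_eq_zero_iff.1 ⟨fun U : ↥𝒮 => ∏ i ∈ (U : Finset ι), t i, ?_, ?_⟩
    · intro h
      have := congrFun h ⟨∅, h0⟩
      simp at this
    · funext T
      rw [hM, root_vecMul ℓ t ht hΔ z hz T, hE, zero_mul, Pi.zero_apply]
  have hdvd : (q : ℤ) ∣ M.det := by
    rw [← CharP.intCast_eq_zero_iff F q, ← eq_intCast (Int.castRingHom F), RingHom.map_det]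
    exact hdetF
  -- (2) `|det M| < q`, hence `det M = 0`
  have hdet0 : M.det = 0 :=
    Int.eq_zero_of_abs_lt_dvd hdvd (lt_of_le_of_lt (abs_det_le ℓ hℓ z hB) hq)
  -- (3) a non-zero integer vector in the kernel: `z ⋆ ū = 0`
  obtain ⟨u, hu0, hu⟩ := Matrix.exists_mulVec_eq_zero_iff.2 hdet0
  set ub : Finset ι → ℤ := fun S => if h : S ∈ 𝒮 then u ⟨S, h⟩ else 0 with hub
  have hub0 : ∀ S, S ∉ 𝒮 → ub S = 0 := fun S hS => by simp [hub, hS]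
  have hstar : ∀ U : Finset ι, (∑ S : Finset ι, z S * ub (symmDiff S U) * ∏ i ∈ S \ U, (ℓ i : ℤ)) = 0 := by
    intro U
    by_cases hU : U ∈ 𝒮
    · have := congrFun hu ⟨U, hU⟩
      rw [hM, mulVec_eq_star ℓ z u ⟨U, hU⟩] at this
      exact this
    · exact star_support ℓ hΔ hz hub0 hU
  -- (4) evaluate in `ℝ` at `t_i = √ℓ_i`
  set tr : ι → ℝ := fun i => Real.sqrt (ℓ i) with htr
  have htr2 : ∀ i, tr i ^ 2 = (ℓ i : ℝ) := fun i => Real.sq_sqrt (Nat.cast_nonneg _)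
  have hprodR : (∑ S : Finset ι, (z S : ℝ) * ∏ i ∈ S, tr i) * (∑ T : Finset ι, (ub T : ℝ) * ∏ i ∈ T, tr i)
      = 0 := by
    rw [eval_star ℓ tr htr2 z ub]
    refine Finset.sum_eq_zero fun U _ => ?_
    rw [hstar U]; simp
  have hsqrt : ∀ S : Finset ι, ∏ i ∈ S, tr i = Real.sqrt (∏ i ∈ S, ((ℓ i : ℕ) : ℝ)) := fun S => by
    rw [Real.sqrt_prod _ fun i _ => Nat.cast_nonneg (ℓ i)]
  simp_rw [hsqrt] at hprodR
  rcases mul_eq_zero.1 hprodR with h | h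
  · exact SqrtIndep.sqrt_prod_indep_int ℓ hprime hinj z h
  · exfalso
    have hub' := SqrtIndep.sqrt_prod_indep_int ℓ hprime hinj ub h
    apply hu0
    funext T
    have := congrFun hub' (T : Finset ι)
    simp only [hub, Pi.zero_apply, dif_pos T.2] at this
    exact this

end Summit.MatrixMultiplication.MatrixMultiplication.Theorems.LevelOneGL2Designs.Multiquadratic
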